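import Literature.NumberTheory.LFunctions.SiegelEstermannLemma
import HarnessLib

/-!
# Estermann's lemma for a Dirichlet series with a simple pole, on a disc `|s − 2| ≤ R` (`1 < R ≤ 3/2`)

Topic `Literature/NumberTheory/LFunctions`, next to `SiegelEstermannLemma.lean` (Montgomery–Vaughan,
*Multiplicative Number Theory I*, Lemma 11.13, for `F = ζ f` with `f` ENTIRE and the disc
`|s − 2| ≤ 3/2`). Everything in this file is PROVED (theorems only; no named facts).

**Purpose.** Siegel's theorem for the real Hecke (ray-class) characters of a number field `K` — the
input, together with `L(1, χ) ≠ 0`, for the uniformity in the modulus `q ≤ (log z)^A` of the prime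
number theorem with Grössencharakteren (T. Mitsui, Jap. J. Math. 26 (1956), Lemma 5; "Lemma 9.4" of
D. R. Heath-Brown, *Primes represented by `x³ + 2y³`*, Acta Math. 186 (2001), p. 55: "Mitsui's
treatment employs the familiar arguments concerning Siegel zeros") — runs through Estermann's lemma
applied to `F = ζ_K(s) L(s, χ)` and `F = ζ_K(s) L(s, χ₁) L(s, χ₂) L(s, χ₁χ₂)`. In the tree `ζ_K` and the
twisted `L`-functions are continued only to a half-plane `σ > θ` (`θ = 1 − 1/[K:ℚ]` for `ζ_K`,
`DedekindZetaHalfPlaneProofs`; `σ > θ` from the twisted ideal counts, `LSeriesContinuationOfPartialSums`),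
not to the whole disc `|s − 2| ≤ 3/2` of MV's proof, and the factor `ζ` is replaced by `ζ_K` (residue
`γ₀ ≠ 1`). MV's proof uses of `F` only: non-negative coefficients with `r(1) = 1`, and that
`H(s) = (s − 1)F(s)` is holomorphic and bounded on a disc around `2` containing `1` and `β` in its
interior. We therefore run it once in this ABSTRACT form, on the disc of radius `R ∈ (1, 3/2]`:

Let `1 < R ≤ 3/2`, `U ⊇ closedBall 2 R` open, `H : ℂ → ℂ` holomorphic on `U` with `‖H(s)‖ ≤ M`
(`M ≥ 1`) on `closedBall 2 R`; `a : ℕ → ℂ` with `a ≥ 0`, `a(1) = 1`, `∑ a(n) n^{-s}` absolutely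
convergent and `H(s) = (s − 1) ∑ a(n) n^{-s}` for `Re s > 1`; and `β ∈ [1 − (R − 1)/2, 1)` real with
`Re H(β) ≥ 0` (i.e. `Re F(β) ≤ 0`; in the applications `H(β) = 0` at a real zero, or `H(σ) > 0` on
`[1 − η, 1]` in the zero-free case). Then (`EstermannDisc.estermann_lemma_disc`)

  `Re H(1) ≥ c_R (1 − β) M^{−A_R (1 − β)}`,

with `A_R = 1/log(2R/(R + 1))` and `c_R = ½ exp(−((R − 1)/2)(1 + A_R log(8R/(R − 1)²)))`
(`EstermannDisc.discA`, `EstermannDisc.discC`), depending on `R` alone. For `F = ζ f`, `R = 3/2`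
(`H = ζ₁ f`, `H(1) = f(1)`) this is MV Lemma 11.13 with `A = 1/log(6/5)`; for `F = ζ_K f` one gets
`Re γ₀ f(1) ≥ …`, `γ₀ = Res_{s=1} ζ_K`.

Proof (MV pp. 283–284 verbatim, with `3/2 ↦ R`): `G = dslope H 1` is holomorphic on `U` and equals
`F(s) − H(1)/(s − 1)` off `s = 1`; on `|s − 2| = R`, `|s − 1| ≥ R − 1`, so `|G| ≤ 2M/(R − 1)` and
Cauchy's inequalities give `|G^{(k)}(2)/k!| ≤ (2M/(R − 1)) R^{-k}`. Near `2`,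
`G = ∑ a(n)n^{-s} − H(1)/(s − 1)`, so `(−1)^k G^{(k)}(2)/k! = b_k − H(1)`, `b_k ≥ 0`, `Re b_0 ≥ 1`
(`Estermann.re_alternating_iteratedDeriv_nonneg`, `Estermann.one_le_re_LSeries_two`). The Taylor
series at `2` converges at `β` (`|β − 2| ≤ (R + 1)/2 < R`, `Complex.hasSum_taylorSeries_on_ball`);
truncating at `N` with `(2M/(R − 1)) ρ^N/(1 − ρ) ≤ ½`, `ρ = (R + 1)/(2R)`, and using
`Re G(β) = Re (H(β) − H(1))/(β − 1) ≤ Re H(1)/(1 − β)` gives `Re H(1) (2 − β)^N/(1 − β) ≥ ½`, and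
`(2 − β)^N ≤ e^{N(1 − β)} ≤ e^{(R−1)/2 · (1 + A_R log(8R/(R−1)²))} M^{A_R(1 − β)}`.

## References

* H. L. Montgomery, R. C. Vaughan, *Multiplicative Number Theory I. Classical Theory*, Cambridge
  Stud. Adv. Math. 97, CUP 2007, §11.2, Lemma 11.13, pp. 283–284 (the proof).
  [cite: MontgomeryVaughan2007, §11.2 Lemma 11.13]
* T. Estermann, *On Dirichlet's L functions*, J. London Math. Soc. 23 (1948), 275–279. [folklore]
* D. R. Heath-Brown, *Primes represented by `x³ + 2y³`*, Acta Math. 186 (2001), §9 p. 55 (the use).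
  [cite: HeathBrownActa2001, §9 Lemma 9.4]

## Mathlib / tree search

Tree: `Literature.NumberTheory.LFunctions.Estermann.{real_core, estermann_lemma, iteratedDeriv_inv_sub_one_two,
re_alternating_iteratedDeriv_nonneg, one_le_re_LSeries_two}` (`SiegelEstermannLemma.lean`: `ζ` and an
entire `P` hard-wired; the last three lemmas are reused here); `lean search 'estermann|Estermann' --decl`:
nothing else. Mathlib: `Complex.differentiableOn_dslope`, `DifferentiableOn.diffContOnCl_ball`,
`Complex.norm_iteratedDeriv_le_of_forall_mem_sphere_norm_le`, `Complex.hasSum_taylorSeries_on_ball`,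
`LSeries_analyticOnNhd`, `iteratedDeriv_const_mul`.
-/

noncomputable section

open Complex Filter Topology Finset Metric
open scoped ComplexOrder Nat

namespace Literature.NumberTheory.LFunctions.EstermannDisc

open Literature.NumberTheory.LFunctions.Estermann

/-! ### Constants depending on the radius `R` -/

/-- The ratio `ρ_R = (R + 1)/(2R)` (`= (2 − β)/R` at the worst `β = 1 − (R − 1)/2`; `5/6` for
`R = 3/2`). [cite: MontgomeryVaughan2007, §11.2 Lemma 11.13 (proof)] -/
def discRho (R : ℝ) : ℝ := (R + 1) / (2 * R)

/-- The exponent constant `A_R = 1/log(1/ρ_R) = 1/log(2R/(R + 1))` (`1/log(6/5)` for `R = 3/2`).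
[cite: MontgomeryVaughan2007, §11.2 Lemma 11.13] -/
def discA (R : ℝ) : ℝ := 1 / Real.log (2 * R / (R + 1))

/-- The auxiliary constant `ℓ_R = log(8R/(R − 1)²)` (`= log(4/((R − 1)(1 − ρ_R)))`). [folklore] -/
def discL (R : ℝ) : ℝ := Real.log (8 * R / (R - 1) ^ 2)

/-- The multiplicative constant `c_R = ½ exp(−((R − 1)/2)(1 + A_R ℓ_R))`.
[cite: MontgomeryVaughan2007, §11.2 Lemma 11.13] -/
def discC (R : ℝ) : ℝ := 1 / 2 * Real.exp (-((R - 1) / 2 * (1 + discA R * discL R)))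

section Constants

variable {R : ℝ}

/-- `1/ρ_R = 2R/(R + 1)`. [folklore] -/
lemma inv_discRho : (discRho R)⁻¹ = 2 * R / (R + 1) := by
  unfold discRho; rw [inv_div]

/-- `c_R > 0`. [folklore] -/
lemma discC_pos : 0 < discC R := by unfold discC; positivity

variable (hR1 : 1 < R) (hR2 : R ≤ 3 / 2)
include hR1

/-- `0 < ρ_R`. [folklore] -/
lemma discRho_pos : 0 < discRho R := by unfold discRho; positivity

/-- `ρ_R < 1`. [folklore] -/
lemma discRho_lt_one : discRho R < 1 := by
  unfold discRho; rw [div_lt_one (by positivity)]; linarith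

/-- `log(2R/(R + 1)) > 0`. [folklore] -/
lemma log_inv_discRho_pos : 0 < Real.log (2 * R / (R + 1)) := by
  apply Real.log_pos; rw [one_lt_div (by positivity)]; linarith

/-- `A_R > 0`. [folklore] -/
lemma discA_pos : 0 < discA R := by
  unfold discA; exact div_pos one_pos (log_inv_discRho_pos hR1)

/-- `1 − ρ_R = (R − 1)/(2R)`. [folklore] -/
lemma one_sub_discRho : 1 - discRho R = (R - 1) / (2 * R) := by
  unfold discRho; field_simp; ring

/-- `4/((R − 1)(1 − ρ_R)) = 8R/(R − 1)²`. [folklore] -/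
lemma four_div_eq : 4 / ((R - 1) * (1 - discRho R)) = 8 * R / (R - 1) ^ 2 := by
  rw [one_sub_discRho hR1]
  have hR0 : R - 1 ≠ 0 := by linarith
  have hR : R ≠ 0 := by linarith
  field_simp
  ring

include hR2 in
/-- `ℓ_R ≥ 0` (indeed `8R/(R − 1)² ≥ 48` for `R ≤ 3/2`). [folklore] -/
lemma discL_nonneg : 0 ≤ discL R := by
  unfold discL
  apply Real.log_nonneg
  rw [le_div_iff₀ (by nlinarith)]
  nlinarith

end Constants

/-! ### The real-variable core, with a general geometric majorant -/

/-- **The bookkeeping of MV pp. 283–284, general ratio.** Let `B ≥ 0`, `0 < ρ < 1`, `β < 1` with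
`0 < 2 − β`, `λ ∈ ℝ`, and let `∑ t_k = T` be a convergent real series with `t_0 ≥ 1 − λ`,
`t_k ≥ −λ (2−β)^k` (`k ≥ 1`), `|t_k| ≤ B ρ^k`, and `T ≤ λ/(1−β)`. If `N ≥ 1` satisfies
`B ρ^N/(1 − ρ) ≤ ½` then `λ ≥ (1 − β)/(2(2 − β)^N)`. [cite: MontgomeryVaughan2007, §11.2 Lemma 11.13, pp. 283–284] -/
theorem real_core_general {B ρ lam β T : ℝ} {t : ℕ → ℝ} {N : ℕ} (hρ0 : 0 < ρ) (hρ1 : ρ < 1)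
    (hβ1 : β < 1) (ht : HasSum t T) (h0 : 1 - lam ≤ t 0)
    (hk : ∀ k, 1 ≤ k → -(lam * (2 - β) ^ k) ≤ t k) (habs : ∀ k, |t k| ≤ B * ρ ^ k)
    (hT : T ≤ lam / (1 - β)) (hN1 : 1 ≤ N) (hN : B * ρ ^ N / (1 - ρ) ≤ 1 / 2) :
    (1 - β) / (2 * (2 - β) ^ N) ≤ lam := by
  have h1β : 0 < 1 - β := by linarith
  have h2β : 0 < 2 - β := by linarith
  -- split the series at `N`
  have hsplit : (∑ k ∈ range N, t k) + ∑' k, t (k + N) = T := by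
    rw [ht.summable.sum_add_tsum_nat_add N, ht.tsum_eq]
  have hgeom : ∑ k ∈ range N, (2 - β) ^ k = ((2 - β) ^ N - 1) / (1 - β) := by
    rw [geom_sum_eq (by linarith : (2 - β : ℝ) ≠ 1)]
    congr 1; ring
  have hhead : 1 - lam * ∑ k ∈ range N, (2 - β) ^ k ≤ ∑ k ∈ range N, t k := by
    have hu : ∀ k ∈ range N, (if k = 0 then 1 else 0) - lam * (2 - β) ^ k ≤ t k := by
      intro k _
      rcases Nat.eq_zero_or_pos k with rfl | hk0
      · simpa using h0
      · simp only [hk0.ne', ↓reduceIte, zero_sub]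
        exact hk k hk0
    have := Finset.sum_le_sum hu
    rw [Finset.sum_sub_distrib, ← Finset.mul_sum, Finset.sum_ite_eq' (range N) 0] at this
    have hN0 : (0 : ℕ) ∈ range N := Finset.mem_range.mpr (by omega)
    rw [if_pos hN0] at this
    linarith
  have hB0 : 0 ≤ B := by
    have := habs 0
    simp only [pow_zero, mul_one] at this
    exact (abs_nonneg _).trans this
  have htail' : ‖∑' k, t (k + N)‖ ≤ B * ρ ^ N * (1 - ρ)⁻¹ := by
    refine tsum_of_norm_bounded
      ((hasSum_geometric_of_lt_one hρ0.le hρ1).mul_left _) fun k => ?_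
    rw [Real.norm_eq_abs]
    calc |t (k + N)| ≤ B * ρ ^ (k + N) := habs _
      _ = B * ρ ^ N * ρ ^ k := by rw [pow_add]; ring
  have htail'' : -(1 / 2 : ℝ) ≤ ∑' k, t (k + N) := by
    rw [Real.norm_eq_abs] at htail'
    have := neg_abs_le (∑' k, t (k + N))
    rw [← div_eq_mul_inv] at htail'
    linarith
  have hcomb : 1 / 2 ≤ lam * ((2 - β) ^ N / (1 - β)) := by
    have h1 : 1 - lam * ∑ k ∈ range N, (2 - β) ^ k - 1 / 2 ≤ lam / (1 - β) := by linarith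
    rw [hgeom] at h1
    have : lam / (1 - β) + lam * (((2 - β) ^ N - 1) / (1 - β)) = lam * ((2 - β) ^ N / (1 - β)) := by
      field_simp; ring
    linarith
  have hpow : 0 < (2 - β) ^ N := pow_pos h2β N
  rw [div_le_iff₀ (by positivity)]
  have := hcomb
  rw [mul_div_assoc', le_div_iff₀ h1β] at this
  linarith

/-! ### The function `G = dslope H 1` -/

/-- `G = dslope H 1`: the holomorphic function equal to `(H(s) − H(1))/(s − 1) = F(s) − H(1)/(s − 1)`
off `s = 1` (MV (11.16) with `ζ f ↦ F = H/(s − 1)`). [cite: MontgomeryVaughan2007, §11.2 eq. (11.16)] -/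
def G (H : ℂ → ℂ) : ℂ → ℂ := dslope H 1

variable {H : ℂ → ℂ} {U : Set ℂ} {R M : ℝ}

/-- `1 ∈ closedBall 2 R` for `R ≥ 1`. [folklore] -/
lemma one_mem_closedBall (hR1 : 1 ≤ R) : (1 : ℂ) ∈ closedBall (2 : ℂ) R := by
  rw [mem_closedBall, dist_eq_norm]; norm_num; exact hR1

/-- `G` is holomorphic on `U` when `H` is and `U` is a neighbourhood of `1` (removable singularity).
[folklore] -/
lemma differentiableOn_G (hU : U ∈ 𝓝 (1 : ℂ)) (hH : DifferentiableOn ℂ H U) :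
    DifferentiableOn ℂ (G H) U :=
  (Complex.differentiableOn_dslope hU).mpr hH

/-- `G(s) = (H(s) − H(1))/(s − 1)` for `s ≠ 1`. [folklore] -/
lemma G_eq_of_ne_one (H : ℂ → ℂ) {s : ℂ} (hs : s ≠ 1) : G H s = (H s - H 1) / (s - 1) := by
  rw [G, dslope_of_ne _ hs, slope_def_field]

/-- Geometry of the circle `|s − 2| = R`, `R > 1`: `s ≠ 1` and `|s − 1| ≥ R − 1`. [folklore] -/
lemma sphere_facts (hR1 : 1 < R) {s : ℂ} (hs : s ∈ sphere (2 : ℂ) R) :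
    s ≠ 1 ∧ R - 1 ≤ ‖s - 1‖ := by
  rw [mem_sphere_iff_norm] at hs
  have h2 : ‖s - 2‖ ≤ ‖s - 1‖ + ‖(1 : ℂ)‖ := by
    calc ‖s - 2‖ = ‖(s - 1) - 1‖ := by ring_nf
      _ ≤ ‖s - 1‖ + ‖(1 : ℂ)‖ := norm_sub_le _ _
  rw [hs, norm_one] at h2
  refine ⟨?_, by linarith⟩
  rintro rfl
  norm_num at h2
  linarith

/-- On `|s − 2| = R`: `|G(s)| ≤ 2M/(R − 1)` when `|H| ≤ M` on the closed disc. [cite: MontgomeryVaughan2007, §11.2 p. 284] -/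
lemma norm_G_le_of_mem_sphere (hR1 : 1 < R) (hHM : ∀ s ∈ closedBall (2 : ℂ) R, ‖H s‖ ≤ M) {s : ℂ}
    (hs : s ∈ sphere (2 : ℂ) R) : ‖G H s‖ ≤ 2 * M / (R - 1) := by
  obtain ⟨hs1, hlow⟩ := sphere_facts hR1 hs
  have hHs : ‖H s‖ ≤ M := hHM s (sphere_subset_closedBall hs)
  have hH1 : ‖H 1‖ ≤ M := hHM 1 (one_mem_closedBall hR1.le)
  have hden : (0 : ℝ) < ‖s - 1‖ := by linarith
  have hR0 : 0 < R - 1 := by linarith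
  rw [G_eq_of_ne_one H hs1, norm_div, div_le_div_iff₀ hden hR0]
  calc ‖H s - H 1‖ * (R - 1) ≤ (‖H s‖ + ‖H 1‖) * (R - 1) := by
        gcongr; exact norm_sub_le _ _
    _ ≤ (M + M) * (R - 1) := by gcongr
    _ = 2 * M * (R - 1) := by ring
    _ ≤ 2 * M * ‖s - 1‖ := by
        have hM : 0 ≤ M := (norm_nonneg _).trans hH1
        gcongr

/-- **Cauchy's inequalities** for `G` on `|s − 2| = R`: `|G^{(k)}(2)| ≤ k! (2M/(R − 1)) R^{-k}`.
[cite: MontgomeryVaughan2007, §11.2 p. 284] -/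
lemma norm_iteratedDeriv_G_le (hR1 : 1 < R) (hU : IsOpen U) (hsub : closedBall (2 : ℂ) R ⊆ U)
    (hH : DifferentiableOn ℂ H U) (hHM : ∀ s ∈ closedBall (2 : ℂ) R, ‖H s‖ ≤ M) (k : ℕ) :
    ‖iteratedDeriv k (G H) 2‖ ≤ k ! * (2 * M / (R - 1)) / R ^ k := by
  have hG : DifferentiableOn ℂ (G H) U :=
    differentiableOn_G (hU.mem_nhds (hsub (one_mem_closedBall hR1.le))) hH
  exact Complex.norm_iteratedDeriv_le_of_forall_mem_sphere_norm_le k (by linarith)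
    (hG.diffContOnCl_ball hsub) fun _ hz => norm_G_le_of_mem_sphere hR1 hHM hz

/-- Near `s = 2`, `G = ∑ a(n) n^{-s} − H(1)/(s − 1)`; hence
`G^{(k)}(2) = F^{(k)}(2) − H(1) (−1)^k k!`, `F(s) = ∑ a(n) n^{-s}` (MV (11.15)–(11.16)).
[cite: MontgomeryVaughan2007, §11.2 eqs. (11.15)–(11.16)] -/
lemma iteratedDeriv_G_two {a : ℕ → ℂ} (habs : LSeries.abscissaOfAbsConv a < (2 : ℝ))
    (hL : ∀ s : ℂ, 1 < s.re → H s = (s - 1) * LSeries a s) (k : ℕ) :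
    iteratedDeriv k (G H) 2 = iteratedDeriv k (LSeries a) 2 - H 1 * ((-1) ^ k * k !) := by
  have hev : G H =ᶠ[𝓝 (2 : ℂ)] fun s => LSeries a s - H 1 * (s - 1)⁻¹ := by
    have hmem : {s : ℂ | 1 < s.re} ∈ 𝓝 (2 : ℂ) :=
      (isOpen_lt continuous_const continuous_re).mem_nhds (by simp)
    filter_upwards [hmem] with s hs
    have hs1 : s ≠ 1 := by rintro rfl; simp at hs
    have h1 : s - 1 ≠ 0 := sub_ne_zero.mpr hs1
    rw [G_eq_of_ne_one H hs1, hL s hs]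
    field_simp
  rw [hev.iteratedDeriv_eq k]
  have h2 : (2 : ℂ) ∈ {s : ℂ | LSeries.abscissaOfAbsConv a < s.re} := by
    simp only [Set.mem_setOf_eq]
    exact_mod_cast habs
  have hA : ContDiffAt ℂ k (LSeries a) 2 := ((LSeries_analyticOnNhd a) 2 h2).contDiffAt
  have hinv : ContDiffAt ℂ k (fun s : ℂ => (s - 1)⁻¹) 2 :=
    (contDiffAt_id.sub contDiffAt_const).inv (by norm_num)
  have hB : ContDiffAt ℂ k (fun s : ℂ => H 1 * (s - 1)⁻¹) 2 := contDiffAt_const.mul hinv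
  rw [iteratedDeriv_fun_sub hA hB, iteratedDeriv_const_mul _ hinv, iteratedDeriv_inv_sub_one_two]

/-! ### Estermann's lemma on the disc -/

/-- **Estermann's lemma, abstract disc form** (MV Lemma 11.13 with `ζ f ↦ F`, `3/2 ↦ R`): for
`1 < R ≤ 3/2`, `H` holomorphic on an open `U ⊇ closedBall 2 R` with `|H| ≤ M` (`M ≥ 1`) there,
`a ≥ 0` with `a(1) = 1`, `∑ a(n) n^{-s}` absolutely convergent and `H(s) = (s − 1)∑ a(n) n^{-s}` on
`Re s > 1`, and `β ∈ [1 − (R − 1)/2, 1)` with `Re H(β) ≥ 0`: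
`Re H(1) ≥ c_R (1 − β) M^{−A_R (1 − β)}`. [cite: MontgomeryVaughan2007, §11.2 Lemma 11.13, pp. 283–284] -/
theorem estermann_lemma_disc (hR1 : 1 < R) (hR2 : R ≤ 3 / 2) (hU : IsOpen U)
    (hsub : closedBall (2 : ℂ) R ⊆ U) (hH : DifferentiableOn ℂ H U) (hM : 1 ≤ M)
    (hHM : ∀ s ∈ closedBall (2 : ℂ) R, ‖H s‖ ≤ M)
    {a : ℕ → ℂ} (ha : 0 ≤ a) (ha1 : a 1 = 1) (hsum : ∀ s : ℂ, 1 < s.re → LSeriesSummable a s)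
    (hL : ∀ s : ℂ, 1 < s.re → H s = (s - 1) * LSeries a s)
    {β : ℝ} (hβ : 1 - (R - 1) / 2 ≤ β) (hβ1 : β < 1) (hHβ : 0 ≤ (H β).re) :
    discC R * (1 - β) * M ^ (-(discA R * (1 - β))) ≤ (H 1).re := by
  have hM0 : 0 < M := by linarith
  have h1β : 0 < 1 - β := by linarith
  have h2β : 0 < 2 - β := by linarith
  have hκ : 1 - β ≤ (R - 1) / 2 := by linarith
  -- abscissa of absolute convergence
  have habs1 : LSeries.abscissaOfAbsConv a ≤ (1 : ℝ) :=
    LSeries.abscissaOfAbsConv_le_of_forall_lt_LSeriesSummable fun y hy => hsum y (by simpa using hy)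
  have habs : LSeries.abscissaOfAbsConv a < (2 : ℝ) :=
    habs1.trans_lt (by exact_mod_cast (by norm_num : (1 : ℝ) < 2))
  have hsum2 : LSeriesSummable a 2 := by simpa using hsum 2 (by norm_num)
  -- `G` is holomorphic on `U ⊇ ball 2 R ∋ β`
  have hG : DifferentiableOn ℂ (G H) U :=
    differentiableOn_G (hU.mem_nhds (hsub (one_mem_closedBall hR1.le))) hH
  have hβball : (β : ℂ) ∈ ball (2 : ℂ) R := by
    rw [mem_ball, dist_eq_norm, show (β : ℂ) - 2 = ((β - 2 : ℝ) : ℂ) by push_cast; ring, norm_real,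
      Real.norm_eq_abs, abs_sub_comm, abs_of_pos h2β]
    linarith
  -- Taylor series of `G` at `2`, evaluated at `β`
  set lam : ℝ := (H 1).re with hlam
  set D : ℕ → ℂ := fun k => iteratedDeriv k (G H) 2 with hD
  set t : ℕ → ℝ := fun k => ((k ! : ℂ)⁻¹ * ((β : ℂ) - 2) ^ k * D k).re with htdef
  have hTaylor : HasSum t (G H β).re := by
    have h := Complex.hasSum_taylorSeries_on_ball (hG.mono (ball_subset_closedBall.trans hsub)) hβball
    have h' := Complex.hasSum_re h
    refine h'.congr_fun fun k => ?_
    simp only [htdef, hD, smul_eq_mul, mul_assoc]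
  -- real form of the Taylor coefficients
  have hDk : ∀ k, D k = iteratedDeriv k (LSeries a) 2 - H 1 * ((-1) ^ k * k !) :=
    fun k => iteratedDeriv_G_two habs hL k
  have hfact : ∀ k : ℕ, ((k ! : ℂ)⁻¹ * ((β : ℂ) - 2) ^ k) = (((k ! : ℝ)⁻¹ * (β - 2) ^ k : ℝ) : ℂ) := by
    intro k; push_cast; ring
  have ht_eq : ∀ k, t k = (k ! : ℝ)⁻¹ * (2 - β) ^ k * ((-1) ^ k * iteratedDeriv k (LSeries a) 2).re
      - lam * (2 - β) ^ k := by
    intro k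
    simp only [htdef]
    rw [hfact, re_ofReal_mul, hDk, sub_re]
    have e1 : (H 1 * ((-1) ^ k * (k ! : ℂ))).re = lam * ((-1) ^ k * k !) := by
      rw [show ((-1 : ℂ) ^ k * (k ! : ℂ)) = (((-1 : ℝ) ^ k * k ! : ℝ) : ℂ) by push_cast; ring,
        mul_comm, re_ofReal_mul, hlam]
      ring
    have e2 : ((-1 : ℂ) ^ k * iteratedDeriv k (LSeries a) 2).re =
        (-1) ^ k * (iteratedDeriv k (LSeries a) 2).re := by
      rw [show ((-1 : ℂ) ^ k) = (((-1 : ℝ) ^ k : ℝ) : ℂ) by push_cast; ring, re_ofReal_mul]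
    rw [e1, e2]
    have hk0 : (k ! : ℝ) ≠ 0 := by positivity
    have hβ2 : β - 2 = -(2 - β) := by ring
    rcases Nat.even_or_odd k with he | ho
    · rw [he.neg_one_pow, hβ2, he.neg_pow]
      field_simp
    · rw [ho.neg_one_pow, hβ2, ho.neg_pow]
      field_simp
      ring
  -- the four properties of the coefficients
  have h0 : 1 - lam ≤ t 0 := by
    rw [ht_eq 0]
    simp only [Nat.factorial_zero, Nat.cast_one, inv_one, pow_zero, one_mul, mul_one,
      iteratedDeriv_zero]
    linarith [one_le_re_LSeries_two ha ha1 hsum2]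
  have hk : ∀ k, 1 ≤ k → -(lam * (2 - β) ^ k) ≤ t k := by
    intro k _
    rw [ht_eq k]
    have h1 : 0 ≤ (k ! : ℝ)⁻¹ * (2 - β) ^ k * ((-1) ^ k * iteratedDeriv k (LSeries a) 2).re :=
      mul_nonneg (mul_nonneg (by positivity) (pow_nonneg h2β.le k))
        (re_alternating_iteratedDeriv_nonneg ha habs k)
    linarith
  -- the geometric majorant `|t_k| ≤ (2M/(R−1)) ρ_R^k`
  have hρ0 := discRho_pos hR1
  have hρ1 := discRho_lt_one hR1
  have hR0 : 0 < R := by linarith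
  have hratio : (2 - β) * R⁻¹ ≤ discRho R := by
    rw [discRho, div_eq_mul_inv, mul_inv, ← mul_assoc]
    have : (2 - β) ≤ (R + 1) * 2⁻¹ := by linarith
    exact mul_le_mul_of_nonneg_right this (inv_nonneg.mpr hR0.le)
  set B : ℝ := 2 * M / (R - 1) with hBdef
  have hB0 : 0 < B := by rw [hBdef]; exact div_pos (by linarith) (by linarith)
  have habs' : ∀ k, |t k| ≤ B * discRho R ^ k := by
    intro k
    have hnD := norm_iteratedDeriv_G_le hR1 hU hsub hH hHM k
    calc |t k| ≤ ‖(k ! : ℂ)⁻¹ * ((β : ℂ) - 2) ^ k * D k‖ := abs_re_le_norm _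
      _ = (k ! : ℝ)⁻¹ * (2 - β) ^ k * ‖D k‖ := by
          rw [norm_mul, hfact, norm_real, Real.norm_eq_abs, abs_mul, abs_inv, Nat.abs_cast,
            abs_pow, show |β - 2| = 2 - β by rw [abs_sub_comm]; exact abs_of_nonneg h2β.le]
      _ ≤ (k ! : ℝ)⁻¹ * (2 - β) ^ k * (k ! * B / R ^ k) := by gcongr
      _ = B * ((2 - β) * R⁻¹) ^ k := by
          have hk0 : (k ! : ℝ) ≠ 0 := by positivity
          have hRk : R ^ k ≠ 0 := pow_ne_zero _ hR0.ne'
          rw [mul_pow, inv_pow]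
          field_simp
      _ ≤ B * discRho R ^ k :=
          mul_le_mul_of_nonneg_left
            (pow_le_pow_left₀ (mul_nonneg h2β.le (inv_nonneg.mpr hR0.le)) hratio k) hB0.le
  -- `Re G(β) ≤ λ/(1 − β)` from `Re H(β) ≥ 0`
  have hT : (G H β).re ≤ lam / (1 - β) := by
    have hβ1' : (β : ℂ) ≠ 1 := by
      intro h; have := congrArg Complex.re h; simp at this; linarith
    rw [G_eq_of_ne_one H hβ1', show ((β : ℂ) - 1) = ((β - 1 : ℝ) : ℂ) by push_cast; ring,
      div_ofReal_re, sub_re, ← hlam]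
    have hβneg : β - 1 < 0 := by linarith
    rw [div_le_iff_of_neg hβneg]
    have : lam / (1 - β) * (β - 1) = -lam := by field_simp; ring
    rw [this]
    linarith
  -- choice of `N`
  set κl : ℝ := Real.log (2 * R / (R + 1)) with hκl
  have hκlpos : 0 < κl := log_inv_discRho_pos hR1
  have hL0 : 0 ≤ Real.log (4 * M / ((R - 1) * (1 - discRho R))) := by
    apply Real.log_nonneg
    rw [le_div_iff₀ (mul_pos (by linarith) (by linarith)), one_sub_discRho hR1]
    have : (R - 1) * ((R - 1) / (2 * R)) ≤ 1 := by
      rw [← mul_div_assoc, div_le_one (by linarith)]; nlinarith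
    linarith
  set N : ℕ := ⌊Real.log (4 * M / ((R - 1) * (1 - discRho R))) / κl⌋₊ + 1 with hNdef
  have hN1 : 1 ≤ N := by omega
  have hNtail : B * discRho R ^ N / (1 - discRho R) ≤ 1 / 2 := by
    have h1 : Real.log (4 * M / ((R - 1) * (1 - discRho R))) / κl < N := by
      rw [hNdef]; push_cast; exact Nat.lt_floor_add_one _
    have h2 : Real.log (4 * M / ((R - 1) * (1 - discRho R))) < N * κl := by
      rwa [div_lt_iff₀ hκlpos] at h1
    have h3 : Real.log (4 * M / ((R - 1) * (1 - discRho R))) < Real.log ((discRho R)⁻¹ ^ N) := by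
      rw [Real.log_pow, inv_discRho, ← hκl]; exact h2
    have hpos : 0 < 4 * M / ((R - 1) * (1 - discRho R)) :=
      div_pos (by linarith) (mul_pos (by linarith) (by linarith))
    have h4 : 4 * M / ((R - 1) * (1 - discRho R)) < (discRho R ^ N)⁻¹ := by
      have := (Real.log_lt_log_iff hpos (by positivity)).mp h3
      rwa [inv_pow] at this
    have h5 : (4 * M / ((R - 1) * (1 - discRho R))) * discRho R ^ N ≤ 1 := by
      have hρN : 0 < discRho R ^ N := pow_pos hρ0 N
      have := mul_lt_mul_of_pos_right h4 hρN
      rw [inv_mul_cancel₀ hρN.ne'] at this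
      exact this.le
    rw [hBdef, div_le_iff₀ (by linarith : 0 < 1 - discRho R)]
    have hne1 : R - 1 ≠ 0 := by linarith
    have hne2 : 1 - discRho R ≠ 0 := by linarith
    have e : 2 * M / (R - 1) * discRho R ^ N =
        (4 * M / ((R - 1) * (1 - discRho R))) * discRho R ^ N * ((1 - discRho R) / 2) := by
      field_simp
      ring
    rw [e]
    calc (4 * M / ((R - 1) * (1 - discRho R))) * discRho R ^ N * ((1 - discRho R) / 2)
        ≤ 1 * ((1 - discRho R) / 2) := by gcongr
      _ = 1 / 2 * (1 - discRho R) := by ring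
  -- the core inequality `λ ≥ (1 − β)/(2(2 − β)^N)`
  have hcore := real_core_general hρ0 hρ1 hβ1 hTaylor h0 hk habs' hT hN1 hNtail
  -- `(2 − β)^N ≤ exp((R−1)/2 (1 + A_R ℓ_R)) M^{A_R (1 − β)}`
  have hNle : (N : ℝ) ≤ Real.log (4 * M / ((R - 1) * (1 - discRho R))) / κl + 1 := by
    rw [hNdef]; push_cast
    linarith [Nat.floor_le (div_nonneg hL0 hκlpos.le)]
  have hlogsplit : Real.log (4 * M / ((R - 1) * (1 - discRho R))) = Real.log M + discL R := by
    rw [discL, ← four_div_eq hR1, ← Real.log_mul hM0.ne' (by positivity)]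
    congr 1; field_simp
  have hA : discA R = 1 / κl := by rw [discA, hκl]
  have hexp : (2 - β) ^ N ≤ Real.exp ((R - 1) / 2 * (1 + discA R * discL R)) * M ^ (discA R * (1 - β)) := by
    have e1 : (2 - β) ^ N = Real.exp (Real.log (2 - β) * N) := by
      rw [← Real.rpow_natCast, Real.rpow_def_of_pos h2β]
    have e2 : Real.log (2 - β) ≤ 1 - β := by
      have := Real.log_le_sub_one_of_pos h2β; linarith
    have e3 : Real.log (2 - β) * N ≤ (1 - β) * (Real.log (4 * M / ((R - 1) * (1 - discRho R))) / κl + 1) :=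
      mul_le_mul e2 hNle (Nat.cast_nonneg N) h1β.le
    have hlogM : 0 ≤ Real.log M := Real.log_nonneg hM
    have hLR : 0 ≤ discL R := discL_nonneg hR1 hR2
    have hAR : 0 < discA R := discA_pos hR1
    have e5 : (1 - β) * (Real.log (4 * M / ((R - 1) * (1 - discRho R))) / κl + 1) ≤
        (R - 1) / 2 * (1 + discA R * discL R) + Real.log M * (discA R * (1 - β)) := by
      rw [hlogsplit]
      have expand : (1 - β) * ((Real.log M + discL R) / κl + 1) =
          (1 - β) * (1 + 1 / κl * discL R) + Real.log M * (1 / κl * (1 - β)) := by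
        field_simp; ring
      rw [expand, ← hA]
      have t1 : (1 - β) * (1 + discA R * discL R) ≤ (R - 1) / 2 * (1 + discA R * discL R) :=
        mul_le_mul_of_nonneg_right hκ (by positivity)
      linarith
    calc (2 - β) ^ N = Real.exp (Real.log (2 - β) * N) := e1
      _ ≤ Real.exp ((R - 1) / 2 * (1 + discA R * discL R) + Real.log M * (discA R * (1 - β))) :=
          Real.exp_le_exp.mpr (e3.trans e5)
      _ = Real.exp ((R - 1) / 2 * (1 + discA R * discL R)) * M ^ (discA R * (1 - β)) := by
          rw [Real.exp_add, Real.rpow_def_of_pos hM0]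
  -- conclude
  have hpowN : 0 < (2 - β) ^ N := pow_pos h2β N
  have hfin : discC R * (1 - β) * M ^ (-(discA R * (1 - β))) ≤ (1 - β) / (2 * (2 - β) ^ N) := by
    have hMpow : 0 < M ^ (discA R * (1 - β)) := Real.rpow_pos_of_pos hM0 _
    set c₀ : ℝ := (R - 1) / 2 * (1 + discA R * discL R) with hc₀
    rw [Real.rpow_neg hM0.le, le_div_iff₀ (by positivity)]
    have hC : discC R = 1 / 2 * Real.exp (-c₀) := by rw [discC, hc₀]
    rw [hC, Real.exp_neg]
    have hc₀pos : 0 < Real.exp c₀ := Real.exp_pos c₀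
    calc 1 / 2 * (Real.exp c₀)⁻¹ * (1 - β) * (M ^ (discA R * (1 - β)))⁻¹ * (2 * (2 - β) ^ N)
        = (1 - β) * ((2 - β) ^ N / (Real.exp c₀ * M ^ (discA R * (1 - β)))) := by
          field_simp
      _ ≤ (1 - β) * 1 := by
          refine mul_le_mul_of_nonneg_left ?_ h1β.le
          rw [div_le_one (by positivity)]
          exact hexp
      _ = 1 - β := mul_one _
  exact hfin.trans hcore

/-- **Estermann's lemma, abstract disc form, constants existentially quantified**: for `1 < R ≤ 3/2`
there are `c, A > 0` (depending on `R` alone) such that the conclusion of `estermann_lemma_disc` holds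
with `c (1 − β) M^{−A(1 − β)}`. [cite: MontgomeryVaughan2007, §11.2 Lemma 11.13] -/
theorem exists_estermann_constants (hR1 : 1 < R) (hR2 : R ≤ 3 / 2) :
    ∃ c A : ℝ, 0 < c ∧ 0 < A ∧ ∀ ⦃U : Set ℂ⦄ ⦃H : ℂ → ℂ⦄ ⦃M : ℝ⦄, IsOpen U → closedBall (2 : ℂ) R ⊆ U →
      DifferentiableOn ℂ H U → 1 ≤ M → (∀ s ∈ closedBall (2 : ℂ) R, ‖H s‖ ≤ M) →
      ∀ ⦃a : ℕ → ℂ⦄, 0 ≤ a → a 1 = 1 → (∀ s : ℂ, 1 < s.re → LSeriesSummable a s) →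
        (∀ s : ℂ, 1 < s.re → H s = (s - 1) * LSeries a s) →
        ∀ ⦃β : ℝ⦄, 1 - (R - 1) / 2 ≤ β → β < 1 → 0 ≤ (H β).re →
          c * (1 - β) * M ^ (-(A * (1 - β))) ≤ (H 1).re :=
  ⟨discC R, discA R, discC_pos, discA_pos hR1, fun _U _H _M hU hsub hH hM hHM _a ha ha1 hsum hL _β
    hβ hβ1 hHβ => estermann_lemma_disc hR1 hR2 hU hsub hH hM hHM ha ha1 hsum hL hβ hβ1 hHβ⟩

/-! ### The case `F = ζ f` on `|s − 2| ≤ 3/2` (MV Lemma 11.13 with `f` holomorphic near the disc only) -/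

/-- On the closed disc `|s − 2| ≤ 3/2`: `Re s ≥ 1/2`, `|s| ≤ 7/2`, `|s − 1| ≤ 5/2`, hence
`|ζ₁(s)| ≤ 21` by Titchmarsh (2.12.2) (`‖ζ₁(s)‖ ≤ ‖s‖ + ‖s‖‖s − 1‖/σ`). [cite: MontgomeryVaughan2007, §11.2 p. 284] -/
lemma norm_riemannZeta₁_le_of_mem_closedBall {s : ℂ} (hs : s ∈ closedBall (2 : ℂ) (3 / 2)) :
    ‖riemannZeta₁ s‖ ≤ 21 := by
  rw [mem_closedBall, dist_eq_norm] at hs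
  have hre : 1 / 2 ≤ s.re := by
    have h := abs_re_le_norm (s - 2)
    rw [sub_re] at h
    have h2 : (2 : ℂ).re = 2 := rfl
    rw [h2] at h
    have := neg_abs_le (s.re - 2)
    linarith
  have hn : ‖s‖ ≤ 7 / 2 := by
    calc ‖s‖ = ‖(s - 2) + 2‖ := by ring_nf
      _ ≤ ‖s - 2‖ + ‖(2 : ℂ)‖ := norm_add_le _ _
      _ ≤ 3 / 2 + 2 := by gcongr; norm_num
      _ = 7 / 2 := by norm_num
  have hn1 : ‖s - 1‖ ≤ 5 / 2 := by
    calc ‖s - 1‖ = ‖(s - 2) + 1‖ := by ring_nf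
      _ ≤ ‖s - 2‖ + ‖(1 : ℂ)‖ := norm_add_le _ _
      _ ≤ 3 / 2 + 1 := by gcongr; norm_num
      _ = 5 / 2 := by norm_num
  have hσ : 0 < s.re := by linarith
  refine (Literature.NumberTheory.LFunctions.norm_riemannZeta₁_le_of_re_pos hσ).trans ?_
  have hx : 0 ≤ ‖s‖ * ‖s - 1‖ := by positivity
  have h1 : ‖s‖ * ‖s - 1‖ / s.re ≤ 2 * (‖s‖ * ‖s - 1‖) := by
    rw [div_le_iff₀ hσ]; nlinarith
  have h2 : ‖s‖ * ‖s - 1‖ ≤ 7 / 2 * (5 / 2) := mul_le_mul hn hn1 (norm_nonneg _) (by norm_num)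
  linarith

/-- **MV Lemma 11.13 for `ζ f`, with `f` holomorphic only on a neighbourhood of the disc**
(`estermann_lemma_disc` with `R = 3/2`, `H = ζ₁ f`, `|H| ≤ 21M`): for `f` holomorphic on an open
`U ⊇ closedBall 2 (3/2)` with `|f| ≤ M` (`M ≥ 1`) on the disc, `a ≥ 0`, `a(1) = 1`,
`∑ a(n)n^{-s} = ζ(s)f(s)` absolutely on `Re s > 1`, and `β ∈ [3/4, 1)` with `Re ζ(β)f(β) ≤ 0`:
`Re f(1) ≥ c_{3/2}(1 − β)(21M)^{−A_{3/2}(1 − β)}` (`A_{3/2} = 1/log(6/5)` as in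
`Estermann.estermann_lemma`, which assumes `f` entire). [cite: MontgomeryVaughan2007, §11.2 Lemma 11.13] -/
theorem estermann_lemma_zeta (hU : IsOpen U) (hsub : closedBall (2 : ℂ) (3 / 2) ⊆ U) {P : ℂ → ℂ}
    (hP : DifferentiableOn ℂ P U) (hM : 1 ≤ M) (hPM : ∀ s ∈ closedBall (2 : ℂ) (3 / 2), ‖P s‖ ≤ M)
    {a : ℕ → ℂ} (ha : 0 ≤ a) (ha1 : a 1 = 1) (hsum : ∀ s : ℂ, 1 < s.re → LSeriesSummable a s)
    (hL : ∀ s : ℂ, 1 < s.re → LSeries a s = riemannZeta s * P s)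
    {β : ℝ} (hβ : 3 / 4 ≤ β) (hβ1 : β < 1) (hF : (riemannZeta β * P β).re ≤ 0) :
    discC (3 / 2) * (1 - β) * (21 * M) ^ (-(discA (3 / 2) * (1 - β))) ≤ (P 1).re := by
  have hH : DifferentiableOn ℂ (fun s => riemannZeta₁ s * P s) U :=
    differentiable_riemannZeta₁.differentiableOn.mul hP
  have hM0 : 0 ≤ M := by linarith
  have hHM : ∀ s ∈ closedBall (2 : ℂ) (3 / 2), ‖riemannZeta₁ s * P s‖ ≤ 21 * M := by
    intro s hs
    rw [norm_mul]
    exact mul_le_mul (norm_riemannZeta₁_le_of_mem_closedBall hs) (hPM s hs) (norm_nonneg _)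
      (by norm_num)
  have hL' : ∀ s : ℂ, 1 < s.re → riemannZeta₁ s * P s = (s - 1) * LSeries a s := by
    intro s hs
    have hs1 : s ≠ 1 := by rintro rfl; simp at hs
    have h1 : s - 1 ≠ 0 := sub_ne_zero.mpr hs1
    rw [hL s hs, riemannZeta_eq_inv_sub_mul hs1]
    field_simp
  have hβ1' : (β : ℂ) ≠ 1 := by
    intro h; have := congrArg Complex.re h; simp at this; linarith
  have hHβ : 0 ≤ (riemannZeta₁ β * P β).re := by
    have e : riemannZeta₁ β * P β = ((β - 1 : ℝ) : ℂ) * (riemannZeta β * P β) := by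
      rw [riemannZeta_eq_inv_sub_mul hβ1']
      have h1 : (β : ℂ) - 1 ≠ 0 := sub_ne_zero.mpr hβ1'
      push_cast
      field_simp
    rw [e, re_ofReal_mul]
    have : β - 1 ≤ 0 := by linarith
    exact mul_nonneg_of_nonpos_of_nonpos this hF
  have h := estermann_lemma_disc (R := 3 / 2) (H := fun s => riemannZeta₁ s * P s) (by norm_num) le_rfl
    hU hsub hH (by linarith : (1 : ℝ) ≤ 21 * M) hHM ha ha1 hsum hL' (by linarith) hβ1 hHβ
  simpa only [riemannZeta₁_one, one_mul] using h

end Literature.NumberTheory.LFunctions.EstermannDisc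

end
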